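import Summits.RiemannHypothesis.RiemannHypothesis.Theorems.ThetaTier1ChebClosed
import Summits.RiemannHypothesis.RiemannHypothesis.Theorems.ThetaTier1BridgeMain
import HarnessLib

/-!
# THETA tier-1 — the BRIDGE for the Chebyshev-variant checker, part 1 (RS-free; cc-s2-1, WEIL typing lane; RH-FREE)

The analogue of `ThetaTier1Bridge.lean` for `Row.insCheb`/`Row.RealCertCheb` (`ThetaTier1Cheb.lean`): the RS-free cross term of
handoff-prove-2's ATTEMPT-22 §5 in the interface's currency —

* `ThetaParams.chebN P := e^{−2x₁}` (`= q e^{2δ−2η}`), `ThetaParams.chebConst P := log 4 + 2 log N/√N`,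
  `ThetaParams.crossCheb P := 2·chebConst·M²·(1/m² + e^{−m/(m+1)}/(m+1))`,
  `ThetaParams.lossCheb P t₀ := primesC + crossCheb + arch t₀ + atom` (primed variants next to the interface, THETA-ASSIGN §4
  convention; the RS-free (AN) theorem targets `lossCheb` with `vonMangoldt_logTail_sum_le_cheb`, no Rosser–Schoenfeld hypothesis) —

and `lossCheb_le : (ofRow r).lossCheb (2^{-k}) ≤ r.lossCheb`, `chebN_ge : e² ≤ chebN` from `r.RealCertCheb` (the other lemmas are
those of `ThetaTier1Bridge` re-proved for `envCheb`).  Part 2: `ThetaTier1ChebBridgeMain.lean`.  Nothing here bears on the truth of RH.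
-/

set_option linter.dupNamespace false  -- the mandated namespace repeats `RiemannHypothesis`
set_option autoImplicit false

namespace Summit.RiemannHypothesis.RiemannHypothesis.Theorems.WeilColumn.ThetaMellin.ThetaParams

variable (P : ThetaParams)

/-- `N = e^{−2x₁}` (`= q·e^{2δ−2η}` for `c₂ = 1`): from here on the D6 partial summation uses `ψ`. [this cell, ATTEMPT-22 §5] -/
noncomputable def chebN : ℝ := Real.exp (-2 * P.x₁)

/-- `C(N) = log 4 + 2 log N/√N` — Mathlib's Chebyshev bound gives `ψ(x) ≤ C(N)·x` on `[N, ∞)` for `N ≥ e²`. [this cell, ATTEMPT-22 §5] -/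
noncomputable def chebConst : ℝ := Real.log 4 + 2 * (Real.log P.chebN / Real.sqrt P.chebN)

/-- D6 cross term with the Chebyshev constant: `2·C(N)·M²·(1/m² + e^{−m/(m+1)}/(m+1))`. [this cell, THETA-CERT-cc6 D6] -/
noncomputable def crossCheb : ℝ :=
  2 * P.chebConst * P.M ^ 2 * (1 / (P.m : ℝ) ^ 2 + Real.exp (-(P.m : ℝ) / (P.m + 1)) / (P.m + 1))

/-- D9 with the Chebyshev cross term: `lossCheb t₀ = primesC + crossCheb + arch t₀ + atom`. [this cell, THETA-CERT-cc6 D9] -/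
noncomputable def lossCheb (t₀ : ℝ) : ℝ := P.primesC + P.crossCheb + P.arch t₀ + P.atom

end Summit.RiemannHypothesis.RiemannHypothesis.Theorems.WeilColumn.ThetaMellin.ThetaParams

namespace Summit.RiemannHypothesis.RiemannHypothesis.Theorems.ThetaTier1

open Literature.Analysis.ValidatedNumerics
open Summit.RiemannHypothesis.RiemannHypothesis.Theorems.WeilColumn.ThetaMellin

noncomputable section

variable (r : Row)
section Bridge
variable {r}
/-- `cb_q_pos` (bridge bookkeeping). [this cell] -/
private theorem cb_q_pos (hq : 2 ≤ r.q) : (0 : ℝ) < r.q := by exact_mod_cast (by omega : 0 < r.q)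
/-- `cb_delta_pos` (bridge bookkeeping). [this cell] -/
private theorem cb_delta_pos (hc : r.RealCertCheb) : (0 : ℝ) < r.delta := by exact_mod_cast hc.2.2.2.1
/-- `cb_two_delta_lt` (bridge bookkeeping). [this cell] -/
private theorem cb_two_delta_lt (hc : r.RealCertCheb) : 2 * (r.delta : ℝ) < 7 / 80 := by
  have h' : ((2 * r.delta : ℚ) : ℝ) < ((7 / 80 : ℚ) : ℝ) := Rat.cast_lt.2 hc.2.2.2.2.1
  push_cast at h'
  exact h' 
/-- `cb_sqrt_pos` (bridge bookkeeping). [this cell] -/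
private theorem cb_sqrt_pos (hq : 2 ≤ r.q) : 0 < Real.sqrt r.q := Real.sqrt_pos.2 (cb_q_pos hq)
/-- `cb_log_nonneg` (bridge bookkeeping). [this cell] -/
private theorem cb_log_nonneg (hq : 2 ≤ r.q) : 0 ≤ Real.log r.q := Real.log_nonneg (by exact_mod_cast (by omega : 1 ≤ r.q))
/-- `cb_exp_a` (bridge bookkeeping). [this cell] -/
private theorem cb_exp_a (hq : 2 ≤ r.q) : Real.exp (ofRow r).a = Real.sqrt r.q * Real.exp r.delta := by
  have h0 : (0 : ℝ) ≤ r.q := (cb_q_pos hq).le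
  simp only [ThetaParams.a, ofRow_q, ofRow_δ]
  rw [Real.exp_add, ← Real.log_sqrt h0, Real.exp_log (cb_sqrt_pos hq)]
/-- `cb_eps_eq` (bridge bookkeeping). [this cell] -/
private theorem cb_eps_eq : (ofRow r).ε = 2 * r.delta := by simp [ThetaParams.ε]
/-- `cb_alpha_eq` (bridge bookkeeping). [this cell] -/
private theorem cb_alpha_eq : (ofRow r).α = ((r.alpha : ℚ) : ℝ) := by
  simp only [ThetaParams.α, cb_eps_eq , ofRow_c₂, ofRow_m₀, ofRow_c₁, Row.alpha, Row.eps]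
  push_cast; ring
/-- `cb_alpha_pos` (bridge bookkeeping). [this cell] -/
private theorem cb_alpha_pos (hc : r.RealCertCheb) : 0 < (ofRow r).α := by
  simp only [ThetaParams.α, cb_eps_eq , ofRow_c₂, ofRow_m₀, ofRow_c₁]
  have := cb_two_delta_lt hc
  apply div_pos <;> linarith
/-- `cb_csum_eq` (bridge bookkeeping). [this cell] -/
private theorem cb_csum_eq : (ofRow r).csum = ((r.csum : ℚ) : ℝ) := by
  simp only [ThetaParams.csum, cb_alpha_eq , Row.csum]; push_cast; ring
/-- `cb_csum_pos` (bridge bookkeeping). [this cell] -/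
private theorem cb_csum_pos (hc : r.RealCertCheb) : 0 < (ofRow r).csum := by
  have := cb_alpha_pos hc; simp only [ThetaParams.csum]; linarith
/-- `cb_hmax_eq` (bridge bookkeeping). [this cell] -/
private theorem cb_hmax_eq : (ofRow r).hmax = ((r.hmax : ℚ) : ℝ) := by
  simp only [ThetaParams.hmax, cb_alpha_eq , Row.hmax]; push_cast; rfl

/-- `u₁ = e^{η-δ}/√q` = register 21. -/
private theorem cb_u1_eq (hq : 2 ≤ r.q) : (ofRow r).u₁ = r.envCheb 21 := by
  obtain ⟨-, -, -, -, -, -, -, -, -, -, -, -, -, -, -, h15, -, -, -, -, h20⟩ := r.vals_table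
  rw [r.envCheb_21, h15, h20]
  simp only [ThetaParams.u₁, ThetaParams.x₁, ofRow_η]
  have hs := cb_sqrt_pos hq
  have : (((ETA - r.delta : ℚ)) : ℝ) = 1 / 20 - (r.delta : ℝ) := by push_cast [ETA]; ring
  rw [Real.exp_sub, cb_exp_a hq, this, Real.exp_sub]
  field_simp
/-- `cb_u1_pos` (bridge bookkeeping). [this cell] -/
private theorem cb_u1_pos : 0 < (ofRow r).u₁ := Real.exp_pos _

/-- `ζ⋆ = 4πδq e^{2δ-η}` = register 22. -/
private theorem cb_zstar_eq (hq : 2 ≤ r.q) : (ofRow r).zstar = r.envCheb 22 := by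
  obtain ⟨-, -, -, -, -, -, -, -, -, -, h10, -, -, -, h14, -, -, -, -, -, -⟩ := r.vals_table
  rw [r.envCheb_22, h10, h14]
  simp only [ThetaParams.zstar, ThetaParams.lam, ThetaParams.u₁, ThetaParams.x₁, cb_eps_eq , ofRow_c₂, ofRow_η, div_one]
  have hs := cb_sqrt_pos hq
  have e1 : Real.exp (1 / 20 - (ofRow r).a) = Real.exp (1 / 20) / Real.exp (ofRow r).a := Real.exp_sub _ _
  rw [e1, cb_exp_a hq]
  have : (((2 * r.delta - ETA : ℚ)) : ℝ) = 2 * (r.delta : ℝ) - 1 / 20 := by push_cast [ETA]; ring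
  rw [this, Real.exp_sub, show (2 : ℝ) * r.delta = r.delta + r.delta by ring, Real.exp_add]
  have hq0 : (0 : ℝ) ≤ r.q := (cb_q_pos hq).le
  have hss : Real.sqrt r.q * Real.sqrt r.q = r.q := Real.mul_self_sqrt hq0
  have he : Real.exp (1 / 20 : ℝ) ≠ 0 := (Real.exp_pos _).ne'
  push_cast
  conv_rhs => rw [← hss]
  field_simp
  ring
/-- `cb_zstar_pos` (bridge bookkeeping). [this cell] -/
private theorem cb_zstar_pos (hq : 2 ≤ r.q) (hc : r.RealCertCheb) : 0 < (ofRow r).zstar := by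
  rw [cb_zstar_eq hq, r.envCheb_22]
  obtain ⟨-, -, -, -, -, -, -, -, -, -, h10, -, -, -, h14, -, -, -, -, -, -⟩ := r.vals_table
  rw [h10, h14]
  have hd := cb_delta_pos hc
  have hq' := cb_q_pos hq
  have : (0 : ℝ) < ((4 * r.delta * r.q : ℚ) : ℝ) := by push_cast; positivity
  exact mul_pos this (mul_pos Real.pi_pos (Real.exp_pos _))

/-- `(m/ζ⋆)^m` = register 24, `m/ζ⋆` = register 23. -/
private theorem cb_mz_eq (hq : 2 ≤ r.q) : ((ofRow r).m : ℝ) / (ofRow r).zstar = r.envCheb 23 := by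
  rw [r.envCheb_23, cb_zstar_eq hq, div_eq_mul_inv, ofRow_m, Rat.cast_natCast]
/-- `cb_mzm_eq` (bridge bookkeeping). [this cell] -/
private theorem cb_mzm_eq (hq : 2 ≤ r.q) : (((ofRow r).m : ℝ) / (ofRow r).zstar) ^ (ofRow r).m = r.envCheb 24 := by
  rw [r.envCheb_24, ← cb_mz_eq hq]; rfl
/-- `cb_mz_nonneg` (bridge bookkeeping). [this cell] -/
private theorem cb_mz_nonneg (hq : 2 ≤ r.q) (hc : r.RealCertCheb) : 0 ≤ r.envCheb 23 := by
  rw [← cb_mz_eq hq]; exact div_nonneg (Nat.cast_nonneg _) (cb_zstar_pos hq hc).le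
/-- `cb_zetaTail_nonneg` (bridge bookkeeping). [this cell] -/
private theorem cb_zetaTail_nonneg (s : ℕ) : 0 ≤ ThetaParams.zetaTail s :=
  tsum_nonneg fun n => by positivity
/-- `cb_vonMangoldtSum_nonneg` (bridge bookkeeping). [this cell] -/
private theorem cb_vonMangoldtSum_nonneg (s : ℕ) : 0 ≤ ThetaParams.vonMangoldtSum s :=
  tsum_nonneg fun n => div_nonneg ArithmeticFunction.vonMangoldt_nonneg (by positivity)

/-! ## The closed forms, one register at a time -/

/-- D1: `0 ≤ M ≤` register 25. -/
private theorem cb_M_le (hq : 2 ≤ r.q) (hc : r.RealCertCheb) (hZ : ZetaHyp r.m) : 0 ≤ (ofRow r).M ∧ (ofRow r).M ≤ r.envCheb 25 := by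
  obtain ⟨-, -, -, -, -, -, -, -, -, -, h10, -⟩ := r.vals_table
  have hcs := (cb_csum_pos hc).le
  have hX : 0 ≤ r.envCheb 24 := by rw [r.envCheb_24]; exact pow_nonneg (cb_mz_nonneg hq hc) _
  have eM : (ofRow r).M = (ofRow r).csum * Real.pi⁻¹ * ThetaParams.zetaTail (r.m + 1) * r.envCheb 24 := by
    simp only [ThetaParams.M, ← cb_mzm_eq hq, ofRow_m, div_eq_mul_inv]
  have e25 : r.envCheb 25 = (ofRow r).csum * Real.pi⁻¹ * ((zetaHi (r.m + 1) : ℚ) : ℝ) * r.envCheb 24 := by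
    rw [r.envCheb_25, h10, cb_csum_eq ]
  rw [eM, e25]
  have hpi : 0 ≤ Real.pi⁻¹ := inv_nonneg.2 Real.pi_pos.le
  refine ⟨by have := cb_zetaTail_nonneg (r.m + 1); positivity, ?_⟩
  gcongr
  exact hZ.1

/-- D2: `0 ≤ M₁ ≤` register 26. -/
private theorem cb_M1_le (hq : 2 ≤ r.q) (hc : r.RealCertCheb) (hZ : ZetaHyp r.m) : 0 ≤ (ofRow r).M₁ ∧ (ofRow r).M₁ ≤ r.envCheb 26 := by
  obtain ⟨-, -, -, -, -, -, -, -, -, -, -, -, -, -, h14, -⟩ := r.vals_table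
  have hcs := (cb_csum_pos hc).le
  have hX : 0 ≤ r.envCheb 24 := by rw [r.envCheb_24]; exact pow_nonneg (cb_mz_nonneg hq hc) _
  have h23 := cb_mz_nonneg hq hc
  have hd := (cb_delta_pos hc).le
  have hlu : (ofRow r).lam / (ofRow r).u₁ = r.q * r.vals 14 := by
    rw [h14]
    simp only [ThetaParams.lam, ThetaParams.u₁, ThetaParams.x₁, ofRow_c₂, ofRow_η, div_one]
    have : (((2 * r.delta - ETA : ℚ)) : ℝ) = 2 * (r.delta : ℝ) - 1 / 20 := by push_cast [ETA]; ring
    rw [this, div_eq_iff (Real.exp_pos _).ne', ← Real.exp_log (cb_q_pos hq), ← Real.exp_add, ← Real.exp_add]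
    congr 1
    simp only [ThetaParams.a, ofRow_q, ofRow_δ]
    ring
  have eM1 : (ofRow r).M₁ = 2 * (r.q * r.vals 14) * (ofRow r).csum * (1 + 2 * (r.delta : ℝ) * (1 + r.envCheb 23)) *
      ThetaParams.zetaTail r.m * r.envCheb 24 := by
    simp only [ThetaParams.M₁, hlu, ← cb_mzm_eq hq, ← cb_mz_eq hq, cb_eps_eq, ofRow_c₂, ofRow_m]
  have e26 : r.envCheb 26 = 2 * (r.q * r.vals 14) * (ofRow r).csum * (1 + 2 * (r.delta : ℝ) * (1 + r.envCheb 23)) *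
      ((zetaHi r.m : ℚ) : ℝ) * r.envCheb 24 := by
    rw [r.envCheb_26, cb_csum_eq , Row.eps]; push_cast; ring
  have h14' : 0 ≤ r.vals 14 := by rw [h14]; exact (Real.exp_pos _).le
  rw [eM1, e26]
  refine ⟨by have := cb_zetaTail_nonneg r.m; positivity, ?_⟩
  gcongr
  exact hZ.2

/-- D3: `0 ≤ A ≤` register 27. -/
private theorem cb_A_le (hq : 2 ≤ r.q) (hc : r.RealCertCheb) (hZ : ZetaHyp r.m) : 0 ≤ (ofRow r).A ∧ (ofRow r).A ≤ r.envCheb 27 := by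
  obtain ⟨hM0, hM⟩ := cb_M_le hq hc hZ
  have hu := (cb_u1_pos (r := r)).le
  have eA : (ofRow r).A = 2 / (2 * (r.m : ℝ) + 1) * (ofRow r).M ^ 2 * (ofRow r).u₁ := by
    simp only [ThetaParams.A, ofRow_m]; ring
  have e27 : r.envCheb 27 = 2 / (2 * (r.m : ℝ) + 1) * r.envCheb 25 ^ 2 * (ofRow r).u₁ := by
    rw [r.envCheb_27, cb_u1_eq hq]; push_cast; ring
  rw [eA, e27]
  exact ⟨by positivity, by gcongr⟩

/-- D3: `0 ≤ ‖T′‖₂⁺ ≤` register 28. -/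
private theorem cb_Bin_le (hq : 2 ≤ r.q) (hc : r.RealCertCheb) (hZ : ZetaHyp r.m) : 0 ≤ (ofRow r).Bin ∧ (ofRow r).Bin ≤ r.envCheb 28 := by
  obtain ⟨hM0, hM⟩ := cb_M_le hq hc hZ
  obtain ⟨hM10, hM1⟩ := cb_M1_le hq hc hZ
  have hu := (cb_u1_pos (r := r)).le
  have eB : (ofRow r).Bin = (1 / 2 + (r.m : ℝ) / (1 / 20)) * (ofRow r).M * Real.sqrt ((ofRow r).u₁ * (1 / (2 * (r.m : ℝ) + 1))) +
      (ofRow r).M₁ * Real.sqrt ((ofRow r).u₁ * (1 / (2 * (r.m : ℝ) - 1))) := by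
    simp only [ThetaParams.Bin, ofRow_m, ofRow_η, div_eq_mul_one_div ((ofRow r).u₁)]
  have e28 : r.envCheb 28 = (1 / 2 + (r.m : ℝ) / (1 / 20)) * r.envCheb 25 * Real.sqrt ((ofRow r).u₁ * (1 / (2 * (r.m : ℝ) + 1))) +
      r.envCheb 26 * Real.sqrt ((ofRow r).u₁ * (1 / (2 * (r.m : ℝ) - 1))) := by
    rw [r.envCheb_28, cb_u1_eq hq]; push_cast [ETA]; ring
  rw [eB, e28]
  exact ⟨by positivity, by gcongr⟩

/-- D3: `0 ≤ B ≤` register 29. -/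
private theorem cb_B_le (hq : 2 ≤ r.q) (hc : r.RealCertCheb) (hZ : ZetaHyp r.m) : 0 ≤ (ofRow r).B ∧ (ofRow r).B ≤ r.envCheb 29 := by
  obtain ⟨hB0, hB⟩ := cb_Bin_le hq hc hZ
  rw [r.envCheb_29]
  simp only [ThetaParams.B]
  exact ⟨by positivity, by gcongr⟩

/-- D6: `primesC ≤` register 30. -/
private theorem cb_primesC_le (hq : 2 ≤ r.q) (hc : r.RealCertCheb) (hZ : ZetaHyp r.m) (hΛ : LambdaHyp r.m) : (ofRow r).primesC ≤ r.envCheb 30 := by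
  obtain ⟨hM0, hM⟩ := cb_M_le hq hc hZ
  have hu := (cb_u1_pos (r := r)).le
  have hL := cb_vonMangoldtSum_nonneg (r.m + 1)
  have eP : (ofRow r).primesC = 4 / (2 * (r.m : ℝ) + 1) * ThetaParams.vonMangoldtSum (r.m + 1) * (ofRow r).M ^ 2 * (ofRow r).u₁ := by
    simp only [ThetaParams.primesC, ofRow_m]; ring
  have e30 : r.envCheb 30 = 4 / (2 * (r.m : ℝ) + 1) * ((pLamHi (r.m + 1) : ℚ) : ℝ) * r.envCheb 25 ^ 2 * (ofRow r).u₁ := by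
    rw [r.envCheb_30, cb_u1_eq hq]; push_cast; ring
  have hP : 0 ≤ ((pLamHi (r.m + 1) : ℚ) : ℝ) := by simp only [pLamHi]; positivity
  have hΛ' : ThetaParams.vonMangoldtSum (r.m + 1) ≤ ((pLamHi (r.m + 1) : ℚ) : ℝ) := hΛ
  rw [eP, e30]
  gcongr

/-- `C(N) = log 4 + 2 log N/√N` equals the checker's `2 log 2 + 2 (log q + 2δ − 2η′)·u₁`. [this cell, ATTEMPT-22 §5] -/
private theorem cb_chebConst_eq (hq : 2 ≤ r.q) :
    (ofRow r).chebConst = 2 * r.vals 9 + 2 * (r.vals 19 + ((2 * r.delta - 2 * ETA : ℚ) : ℝ)) * r.envCheb 21 := by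
  obtain ⟨-, -, -, -, -, -, -, -, -, h9, -, -, -, -, -, -, -, -, -, h19, -⟩ := r.vals_table
  rw [h9, h19, ← cb_u1_eq hq]
  simp only [ThetaParams.chebConst, ThetaParams.chebN, ThetaParams.u₁, ThetaParams.x₁, ThetaParams.a, ofRow_η, ofRow_q,
    ofRow_δ, Real.log_exp]
  have hsq : Real.sqrt (Real.exp (-2 * (1 / 20 - (Real.log r.q / 2 + r.delta)))) =
      Real.exp (-(1 / 20 - (Real.log r.q / 2 + r.delta))) := by
    rw [show -2 * (1 / 20 - (Real.log (r.q : ℝ) / 2 + r.delta)) = -(1 / 20 - (Real.log r.q / 2 + r.delta)) +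
      -(1 / 20 - (Real.log r.q / 2 + r.delta)) by ring, Real.exp_add, Real.sqrt_mul_self (Real.exp_pos _).le]
  have hl4 : Real.log 4 = 2 * Real.log 2 := by
    rw [show (4 : ℝ) = 2 ^ 2 by norm_num, Real.log_pow]; norm_num
  rw [hsq, hl4, Real.exp_neg, div_inv_eq_mul]
  have : (((2 * r.delta - 2 * ETA : ℚ)) : ℝ) = 2 * (r.delta : ℝ) - 1 / 10 := by push_cast [ETA]; ring
  rw [this]; ring

/-- `0 < C(N)` (from the side condition `2 ≤ log N`). [this cell] -/
private theorem cb_chebConst_pos (hc : r.RealCertCheb) : 0 < (ofRow r).chebConst := by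
  have hN : 2 ≤ Real.log r.q + (2 * (r.delta : ℝ) - 1 / 10) := hc.2.2.2.2.2.2.2.1
  simp only [ThetaParams.chebConst, ThetaParams.chebN, ThetaParams.x₁, ThetaParams.a, ofRow_η, ofRow_q, ofRow_δ, Real.log_exp]
  have h1 : 0 < Real.log 4 := Real.log_pos (by norm_num)
  have h2 : 0 ≤ -2 * (1 / 20 - (Real.log (r.q : ℝ) / 2 + r.delta)) := by linarith
  have h3 : 0 ≤ -2 * (1 / 20 - (Real.log (r.q : ℝ) / 2 + r.delta)) /
      Real.sqrt (Real.exp (-2 * (1 / 20 - (Real.log (r.q : ℝ) / 2 + r.delta)))) := div_nonneg h2 (Real.sqrt_nonneg _)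
  linarith

/-- **`e² ≤ N`** (the range of Mathlib's Chebyshev bound) from the side condition `2 ≤ log N`. [this cell, ATTEMPT-22 §5] -/
theorem chebN_ge (hc : r.RealCertCheb) : Real.exp 2 ≤ (ofRow r).chebN := by
  have hN : 2 ≤ Real.log r.q + (2 * (r.delta : ℝ) - 1 / 10) := hc.2.2.2.2.2.2.2.1
  simp only [ThetaParams.chebN, ThetaParams.x₁, ThetaParams.a, ofRow_η, ofRow_q, ofRow_δ]
  exact Real.exp_le_exp.2 (by linarith)

/-- D6 (Chebyshev): `crossCheb ≤` register 31 of the variant. [this cell] -/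
private theorem cb_crossCheb_le (hq : 2 ≤ r.q) (hc : r.RealCertCheb) (hZ : ZetaHyp r.m) : (ofRow r).crossCheb ≤ r.envCheb 31 := by
  obtain ⟨hM0, hM⟩ := cb_M_le hq hc hZ
  obtain ⟨-, -, -, -, -, -, -, -, -, -, -, -, -, -, -, -, h16, -⟩ := r.vals_table
  have e16 : r.vals 16 = Real.exp (-(r.m : ℝ) / (r.m + 1)) := by rw [h16]; push_cast; ring_nf
  have hC := (cb_chebConst_pos hc).le
  have eC : (ofRow r).crossCheb = 2 * (ofRow r).chebConst * ((ofRow r).M ^ 2 *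
      (1 / (r.m : ℝ) ^ 2 + Real.exp (-(r.m : ℝ) / (r.m + 1)) * (1 / ((r.m : ℝ) + 1)))) := by
    simp only [ThetaParams.crossCheb, ofRow_m]; ring
  have e31 : r.envCheb 31 = 2 * (ofRow r).chebConst * (r.envCheb 25 ^ 2 *
      (1 / (r.m : ℝ) ^ 2 + Real.exp (-(r.m : ℝ) / (r.m + 1)) * (1 / ((r.m : ℝ) + 1)))) := by
    rw [r.envCheb_31, cb_chebConst_eq hq, e16]; push_cast; ring
  rw [eC, e31]
  have : 0 ≤ 1 / (r.m : ℝ) ^ 2 + Real.exp (-(r.m : ℝ) / (r.m + 1)) * (1 / ((r.m : ℝ) + 1)) := by positivity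
  gcongr

/-- D7: `Jexplicit (2^{-k})` = register 32. -/
private theorem cb_J_eq : ThetaParams.Jexplicit (1 / 2 ^ r.k) = r.envCheb 32 := by
  obtain ⟨h0, h1, h2, h3, h4, h5, h6, h7, h8, h9, -⟩ := r.vals_table
  rw [r.envCheb_32, h0, h1, h2, h3, h4, h5, h6, h7, h8, h9]
  have hl : Real.log (1 / (1 / (2 : ℝ) ^ r.k)) = r.k * Real.log 2 := by rw [one_div_one_div, Real.log_pow]
  simp only [ThetaParams.Jexplicit, hl]
  have hne : (1 : ℝ) - Real.exp (-2) ≠ 0 := by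
    have : Real.exp (-2) < 1 := Real.exp_lt_one_iff.2 (by norm_num)
    linarith
  push_cast
  field_simp
  ring

/-- D7: the clipped arch coefficient, `γ ≥ 1/2`: `(2J − log 4π − γ − C₁) ≤` register 33. -/
private theorem cb_archc_le : 2 * ThetaParams.Jexplicit (1 / 2 ^ r.k) - Real.log (4 * Real.pi) - Real.eulerMascheroniConstant -
    ThetaParams.archC₁ ≤ r.envCheb 33 := by
  obtain ⟨-, -, -, -, -, -, -, -, -, h9, h10, h11, -⟩ := r.vals_table
  rw [r.envCheb_33, ← cb_J_eq , h9, h10, h11, GAMMA_LO]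
  simp only [ThetaParams.archC₁]
  have hγ := Real.one_half_lt_eulerMascheroniConstant
  push_cast
  nlinarith [hγ]

/-- D7: `arch (2^{-k}) ≤` register 34. -/
private theorem cb_arch_le (hq : 2 ≤ r.q) (hc : r.RealCertCheb) (hZ : ZetaHyp r.m) : (ofRow r).arch (1 / 2 ^ r.k) ≤ r.envCheb 34 := by
  obtain ⟨hA0, hA⟩ := cb_A_le hq hc hZ
  obtain ⟨hB0, hB⟩ := cb_B_le hq hc hZ
  obtain ⟨-, -, -, -, -, -, -, -, -, -, -, -, -, -, -, -, -, h17, -⟩ := r.vals_table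
  have e17 : r.vals 17 = Real.exp (1 / 2 ^ r.k / 2) := by rw [h17, Row.t0]; push_cast; ring_nf
  have hc33 := cb_archc_le (r := r)
  have eAr : (ofRow r).arch (1 / 2 ^ r.k) = (ofRow r).B * Real.exp (1 / 2 ^ r.k / 2) * ((1 / 2 ^ r.k) ^ 2 / 4) +
      (ofRow r).A * max 0 (2 * ThetaParams.Jexplicit (1 / 2 ^ r.k) - Real.log (4 * Real.pi) -
        Real.eulerMascheroniConstant - ThetaParams.archC₁) := by
    simp only [ThetaParams.arch]; ring
  have e34 : r.envCheb 34 = r.envCheb 29 * Real.exp (1 / 2 ^ r.k / 2) * ((1 / 2 ^ r.k) ^ 2 / 4) + r.envCheb 27 * max 0 (r.envCheb 33) := by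
    rw [r.envCheb_34, e17, Row.t0]; push_cast; ring
  rw [eAr, e34]
  have hmax : max 0 (2 * ThetaParams.Jexplicit (1 / 2 ^ r.k) - Real.log (4 * Real.pi) - Real.eulerMascheroniConstant -
      ThetaParams.archC₁) ≤ max 0 (r.envCheb 33) := max_le_max le_rfl hc33
  have hm0 : 0 ≤ max 0 (2 * ThetaParams.Jexplicit (1 / 2 ^ r.k) - Real.log (4 * Real.pi) - Real.eulerMascheroniConstant -
      ThetaParams.archC₁) := le_max_left _ _
  have hE : 0 ≤ Real.exp (1 / 2 ^ r.k / 2) := (Real.exp_pos _).le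
  have hc0 : (0 : ℝ) ≤ (1 / 2 ^ r.k) ^ 2 / 4 := by positivity
  have h27 : 0 ≤ r.envCheb 27 := hA0.trans hA
  exact add_le_add (mul_le_mul_of_nonneg_right (mul_le_mul_of_nonneg_right hB hE) hc0) (mul_le_mul hA hmax hm0 h27)

/-- D4: `0 ≤ M_L ≤` register 35. -/
private theorem cb_ML_le (hq : 2 ≤ r.q) (hc : r.RealCertCheb) (hZ : ZetaHyp r.m) : 0 ≤ (ofRow r).ML ∧ (ofRow r).ML ≤ r.envCheb 35 := by
  obtain ⟨hM0, hM⟩ := cb_M_le hq hc hZ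
  obtain ⟨-, -, -, -, -, -, -, -, -, -, -, -, -, -, -, -, -, -, h18, -⟩ := r.vals_table
  have e18 : r.vals 18 = Real.exp ((r.m : ℝ) * (2 * (r.delta : ℝ) - 1 / 20)) := by rw [h18]; push_cast [ETA]; ring_nf
  have eML : (ofRow r).ML = (ofRow r).M * Real.exp ((r.m : ℝ) * (2 * (r.delta : ℝ) - 1 / 20)) := by
    simp only [ThetaParams.ML, ofRow_m, ofRow_δ, ofRow_η]
  rw [r.envCheb_35, e18, eML]
  exact ⟨by positivity, by gcongr⟩

/-- D4: `rbar ≤` register 36 and `0 ≤ rbar`. -/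
private theorem cb_rbar_le (hq : 2 ≤ r.q) (hc : r.RealCertCheb) (hZ : ZetaHyp r.m) (hχ : ChiHyp r) : 0 ≤ (ofRow r).rbar ∧ (ofRow r).rbar ≤ r.envCheb 36 := by
  obtain ⟨hML0, hML⟩ := cb_ML_le hq hc hZ
  obtain ⟨hχ0, hχ1⟩ := hχ
  obtain ⟨-, -, -, -, -, -, -, -, -, -, -, -, -, h13, -, -, -, -, -, -, h20⟩ := r.vals_table
  have hd := (cb_delta_pos hc).le
  have hs := cb_sqrt_pos hq
  have hh : 0 ≤ ((r.hmax : ℚ) : ℝ) := by rw [← cb_hmax_eq ]; simp only [ThetaParams.hmax]; exact le_max_of_le_left zero_le_one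
  have eR : (ofRow r).rbar = 4 * (r.delta : ℝ) * ((r.hmax : ℚ) : ℝ) * (ofRow r).chiL * Real.exp r.delta * (ofRow r).ML +
      2 * (r.delta : ℝ) * (ofRow r).chiL ^ 2 * Real.exp r.delta * (Real.sqrt r.q)⁻¹ * (ofRow r).ML ^ 2 := by
    simp only [ThetaParams.rbar, cb_hmax_eq , ofRow_δ, ofRow_q]; ring
  have e36 : r.envCheb 36 = 4 * (r.delta : ℝ) * ((r.hmax : ℚ) : ℝ) * ((r.chiL : ℚ) : ℝ) * Real.exp r.delta * r.envCheb 35 +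
      2 * (r.delta : ℝ) * ((r.chiL : ℚ) : ℝ) ^ 2 * Real.exp r.delta * (Real.sqrt r.q)⁻¹ * r.envCheb 35 ^ 2 := by
    rw [r.envCheb_36, h13, h20]; push_cast; ring
  rw [eR, e36]
  refine ⟨by positivity, ?_⟩
  have hsi : 0 ≤ (Real.sqrt r.q)⁻¹ := inv_nonneg.2 hs.le
  have hE : 0 ≤ Real.exp (r.delta : ℝ) := (Real.exp_pos _).le
  have h35 : 0 ≤ r.envCheb 35 := hML0.trans hML
  have hχc : 0 ≤ ((r.chiL : ℚ) : ℝ) := hχ0.trans hχ1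
  have t1 : 4 * (r.delta : ℝ) * ((r.hmax : ℚ) : ℝ) * (ofRow r).chiL * Real.exp r.delta * (ofRow r).ML ≤
      4 * (r.delta : ℝ) * ((r.hmax : ℚ) : ℝ) * ((r.chiL : ℚ) : ℝ) * Real.exp r.delta * r.envCheb 35 := by
    have h4 : 0 ≤ 4 * (r.delta : ℝ) * ((r.hmax : ℚ) : ℝ) := by positivity
    exact mul_le_mul (mul_le_mul_of_nonneg_right (mul_le_mul_of_nonneg_left hχ1 h4) hE) hML hML0 (by positivity)
  have t2 : 2 * (r.delta : ℝ) * (ofRow r).chiL ^ 2 * Real.exp r.delta * (Real.sqrt r.q)⁻¹ * (ofRow r).ML ^ 2 ≤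
      2 * (r.delta : ℝ) * ((r.chiL : ℚ) : ℝ) ^ 2 * Real.exp r.delta * (Real.sqrt r.q)⁻¹ * r.envCheb 35 ^ 2 := by
    have hsq1 : (ofRow r).chiL ^ 2 ≤ ((r.chiL : ℚ) : ℝ) ^ 2 := pow_le_pow_left₀ hχ0 hχ1 2
    have hsq2 : (ofRow r).ML ^ 2 ≤ r.envCheb 35 ^ 2 := pow_le_pow_left₀ hML0 hML 2
    have h2 : 0 ≤ 2 * (r.delta : ℝ) := by positivity
    exact mul_le_mul (mul_le_mul_of_nonneg_right (mul_le_mul_of_nonneg_right (mul_le_mul_of_nonneg_left hsq1 h2) hE) hsi)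
      hsq2 (by positivity) (by positivity)
  exact add_le_add t1 t2

/-- D4: `atom ≤` register 37. -/
private theorem cb_atom_le (hq : 2 ≤ r.q) (hc : r.RealCertCheb) (hZ : ZetaHyp r.m) (hχ : ChiHyp r) : (ofRow r).atom ≤ r.envCheb 37 := by
  obtain ⟨hr0, hr⟩ := cb_rbar_le hq hc hZ hχ
  obtain ⟨-, -, -, -, -, -, -, -, -, -, -, -, -, -, -, -, -, -, -, h19, h20⟩ := r.vals_table
  have hs := cb_sqrt_pos hq
  have hl := cb_log_nonneg hq
  have eA : (ofRow r).atom = 2 * Real.log r.q * (Real.sqrt r.q)⁻¹ * (ofRow r).rbar := by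
    simp only [ThetaParams.atom, ofRow_q, div_eq_mul_inv]
  rw [r.envCheb_37, h19, h20, eA]
  have hsi : 0 ≤ (Real.sqrt r.q)⁻¹ := inv_nonneg.2 hs.le
  gcongr

/-- D9 (Chebyshev variant): `P.lossCheb (2^{-k}) ≤ r.lossCheb`. [this cell] -/
theorem lossCheb_le (hq : 2 ≤ r.q) (hc : r.RealCertCheb) (hZ : ZetaHyp r.m) (hΛ : LambdaHyp r.m) (hχ : ChiHyp r) :
    (ofRow r).lossCheb (1 / 2 ^ r.k) ≤ r.lossCheb := by
  rw [r.lossCheb_gainCheb.1, r.envCheb_38, ThetaParams.lossCheb]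
  have h1 := cb_primesC_le hq hc hZ hΛ
  have h2 := cb_crossCheb_le hq hc hZ
  have h3 := cb_arch_le hq hc hZ
  have h4 := cb_atom_le hq hc hZ hχ
  linarith

end Bridge
end

end Summit.RiemannHypothesis.RiemannHypothesis.Theorems.ThetaTier1
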